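/-
Copyright (c) 2026 the pub-hodgecm-mathlib formalisation cell (harness21).  Prover seat hodgecm-mathlib-LH4-p17 (g3); K1a desk K2Liu-p01 (g11) WORD #17 (i)(ii) 2026-09-05T03:14:15Z
«YES §5 of record»: ★ p865024 `hpw_of_leviFrame`'s by-value Levi-frame letter `hFrL hLevi` and the (c)-constant `κ` DISCHARGED AT THE RECORD (★ p864846 `frame_archAt_levi_of_record`,
★ p864217 (A) clause (f), the tube frames of record ★ `exists_tubeFrame_arch₄` (x)).  Track B «K2-LIT», #184♮ = hLiu418 = `stmt-HodgeConjecture-24832`.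
THEOREMS ONLY (no `def`, no instance, no notation, no named-fact hypothesis, no `sorry`, default heartbeats).
-/
import Summits.HodgeConjecture.HodgeConjecture.Theorems.K2LiuKindOneSingularCornerTranslateReading   -- ★ p865024 (this seat): `hpw_of_leviFrame`, `frameConj_mul`
import Summits.HodgeConjecture.HodgeConjecture.Theorems.K2LiuKindOneLineLeviFrameDictionary        -- ★ p864846 (LH4-p14): `frame_archAt_levi_of_record`
import HarnessLib

/-!
# Crux `HLiu418`, socket #41 K1-a♮ (L2-dock)(m1) OF RECORD — `K2LiuKindOneSingularCornerTranslateOfRecord`: the Levi-frame letter `hFrL hLevi` of ★ p865024 `hpw_of_leviFrame`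
# and the (c)-constant `κ`, PAID AT THE FRAMES OF RECORD

Cell `hodgecm-mathlib`, crux item hLiu418 = `stmt-HodgeConjecture-24832`, route `HCCMUnconditional`; squad K2 ∕ K2Liu (L1).  Lane `--supports stmt-HodgeConjecture-24832 --as helper`
(count-neutral).  CLOSES NO SOCKET.  (Sibling file rather than ED.2 of ★ p865024: it needs ★ p864846's imports.)

THE LETTERS.  ★ p865024 `hpw_of_leviFrame … (c c') (A') (hFrL) (hLevi)` takes BY VALUE «the tube frame of the corner translate is the framed Levi block times the frame»:
`hFrL : Fr((gc X·h)_∞) w' = fromBlocks (diag(c w')·σ_{w'}(γ̂ X)·diag(c′ w')) 0 0 (A′ X w') · Fr(h_∞) w'` and `hLevi : (diag c·σγ̂·diag c′)ᴴ·A′ = 1`.  AT THE RECORD — translate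
`gc S = Λ(map γ[w S])` (★ p864217 (A) `htail_hsplit_witnesses_of_record`, clause (f), with its Levi chart `(Λ) (hΛ)` BY VALUE), frames `Fr k w' = T_{w'}·ι_{w'}(k)·T_{w'}⁻¹` (★ `hFr` of
record) at the closed forms `hTdef hTinvdef` of ★ `exists_tubeFrame_arch₄` (x) with `Tinv·T = 1` and `Fr ∈ U(J)` (`hFrU`, ★ arch₄ (iii)) — both letters FOLLOW: `archPart`, `archAt` are
monoid homomorphisms, conjugation by the frame is multiplicative (★ p865024 `frameConj_mul`), ★ p864846 `frame_archAt_levi_of_record` computes the framed Levi block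
`T_{w'}·ι_{w'}(Λγ̂)·T_{w'}⁻¹ = fromBlocks (D·σγ̂·D⁻¹) 0 0 (C·σγ̌·C⁻¹)` (`D = diag √(|t_k|∕2)`), and ★ `levi_mem_iff` turns `U(J)`-membership of a block-diagonal element into `Aᴴ·A′ = 1`.
So the tie feeds ★ p865024 with **`hFrL_of_record`**, **`hLevi_of_record`** (then `c w' k := √(|t_k|∕2)`, `c′ w' k := (√(|t_k|∕2))⁻¹`, `A′` := the `C`-block, all read off by unification) and
★ p865024 `hV_twisted_of_untwistedFloor`'s `hκ` with **`exists_kappa_of_record`** (`∃ κ > 0, κ ≤ 2‖c w' 1‖²‖c′ w' k‖²` on `Tinf`; the value is `2|t₁|∕|t_k|`).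
HONEST LABEL.  Count-neutral bookkeeping at the record; `(Λ) (hΛ) (T Tinv hTdef hTinvdef hT2) (Fr hFr hFrU) (gc hgc)` enter BY VALUE exactly as ★ p864217 ∕ ★ arch₄ ∕ ★ `hFr` print
them; `HC_CM` is proved only modulo the 7 printed citations (2 remaining named inputs: hLiu418 = `stmt-HodgeConjecture-24832`, h413 = `stmt-HodgeConjecture-24833`) until rung 0 closes.

## References
* [Shimura1997] G. Shimura, *Euler Products and Eisenstein Series*, CBMS 93 (1997): §6.4–§6.5 (tube frames, Levi action), §18.1.
* [HarrisKudlaSweet1996] M. Harris, S. Kudla, W. J. Sweet, *Theta dichotomy for unitary groups*, J. AMS 9 (1996): §1 (1.11) (the doubled Levi chart).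
* [KudlaRallis1994] S. Kudla, S. Rallis, *A regularized Siegel–Weil formula: the first term identity*, Ann. of Math. 140 (1994): §2.
-/

set_option autoImplicit false
set_option linter.dupNamespace false -- the mandated namespace repeats `HodgeConjecture.HodgeConjecture`

noncomputable section

open scoped Matrix ComplexConjugate
open Complex Matrix NumberField NumberField.InfinitePlace IsDedekindDomain
open Literature.NumberTheory.GelbartRogawski1991.AdaptedBlocks Literature.NumberTheory.Automorphic Literature.NumberTheory.Automorphic.UnitaryGroup
open Literature.NumberTheory.GelbartRogawski1991 Literature.NumberTheory.GelbartRogawski1991.GRConstruction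
open Literature.NumberTheory.GaloisRepresentations
open UnitaryDualPair

namespace Summit.HodgeConjecture.HodgeConjecture.Cruxes.HLiu418.K2LiuKindOneSingularCornerTranslateOfRecord

open K2LiuSiegelUnipotentFourierDefs
open K2LiuHermitianTubeCocycle (levi_mem_iff)
open K2LiuHermitianTubeFrameArch (tw_ne_zero)
open K2LiuKindOneLineLeviFrameDictionary (frame_archAt_levi_of_record)
open K2LiuKindOneSingularCornerTranslateReading (frameConj_mul)

variable (L : Type) [Field L] [NumberField L] [IsCMField L] {N M : ℕ} (e : Fin N × Fin M ≃ Fin 2)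
  (dV : Fin N → L) (hdV : ∀ i, IsCMField.complexConj L (dV i) = dV i)
  (dW : Fin M → L) (hdW : ∀ i, IsCMField.complexConj L (dW i) = dW i)
  (hdV0 : ∀ i, dV i ≠ 0) (hdW0 : ∀ i, dW i ≠ 0)
  -- the Levi chart of record BY VALUE (★ p864217 (A) :114–:121 ≡ ★ p864846 `Λ₀ hΛ₀` at `n = 2`)
  (Λ : GL (Fin 2) (AdeleRing (𝓞 L) L) →* HA L e dV hdV dW hdW)
  (hΛ : ∀ g : GL (Fin 2) (AdeleRing (𝓞 L) L), blk L e dV hdV dW hdW (Λ g) =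
    cayR (AdeleRing (𝓞 L) L) (Fin 2) * Matrix.fromBlocks (g : Matrix (Fin 2) (Fin 2) (AdeleRing (𝓞 L) L)) 0 0
      (((gramR L e dV hdV dW hdW).map ((algebraMap L (AdeleRing (𝓞 L) L)).comp (algebraMap (Fp L) L)))⁻¹ *
        (((g⁻¹ : GL (Fin 2) (AdeleRing (𝓞 L) L)) : Matrix (Fin 2) (Fin 2) (AdeleRing (𝓞 L) L)).map
          (conjAdele (Fp L) L (IsCMField.complexConj L)))ᵀ *
        (gramR L e dV hdV dW hdW).map ((algebraMap L (AdeleRing (𝓞 L) L)).comp (algebraMap (Fp L) L))) *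
      cayRinv (AdeleRing (𝓞 L) L) (Fin 2))
  -- the tube frames of record BY VALUE (★ `exists_tubeFrame_arch₄` (x) closed forms per complex place, `Tinv·T = 1`) and the frame map `Fr` with ★ `hFr`, `hFrU`
  (T Tinv : {w : InfinitePlace L // w.IsComplex} → Matrix (Fin 2 ⊕ Fin 2) (Fin 2 ⊕ Fin 2) ℂ)
  (hTdef : ∀ w' : {w : InfinitePlace L // w.IsComplex}, T w' = fromBlocks (diagonal (fun k => (Real.sqrt (|(w'.1.embedding (dV (e.symm k).1 * dW (e.symm k).2)).re| / 2) : ℂ)))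
        (diagonal (fun k => (Real.sqrt (|(w'.1.embedding (dV (e.symm k).1 * dW (e.symm k).2)).re| / 2) : ℂ)))
        (diagonal (fun k => I * ((((w'.1.embedding (dV (e.symm k).1 * dW (e.symm k).2)).re / |(w'.1.embedding (dV (e.symm k).1 * dW (e.symm k).2)).re|) *
          Real.sqrt (|(w'.1.embedding (dV (e.symm k).1 * dW (e.symm k).2)).re| / 2) : ℝ) : ℂ)))
        (-diagonal (fun k => I * ((((w'.1.embedding (dV (e.symm k).1 * dW (e.symm k).2)).re / |(w'.1.embedding (dV (e.symm k).1 * dW (e.symm k).2)).re|) *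
          Real.sqrt (|(w'.1.embedding (dV (e.symm k).1 * dW (e.symm k).2)).re| / 2) : ℝ) : ℂ))))
  (hTinvdef : ∀ w' : {w : InfinitePlace L // w.IsComplex}, Tinv w' = fromBlocks (diagonal (fun k => (((Real.sqrt (|(w'.1.embedding (dV (e.symm k).1 * dW (e.symm k).2)).re| / 2))⁻¹ / 2 : ℝ) : ℂ)))
        (-diagonal (fun k => I * (((Real.sqrt (|(w'.1.embedding (dV (e.symm k).1 * dW (e.symm k).2)).re| / 2))⁻¹ *
          ((w'.1.embedding (dV (e.symm k).1 * dW (e.symm k).2)).re / |(w'.1.embedding (dV (e.symm k).1 * dW (e.symm k).2)).re|) / 2 : ℝ) : ℂ)))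
        (diagonal (fun k => (((Real.sqrt (|(w'.1.embedding (dV (e.symm k).1 * dW (e.symm k).2)).re| / 2))⁻¹ / 2 : ℝ) : ℂ)))
        (diagonal (fun k => I * (((Real.sqrt (|(w'.1.embedding (dV (e.symm k).1 * dW (e.symm k).2)).re| / 2))⁻¹ *
          ((w'.1.embedding (dV (e.symm k).1 * dW (e.symm k).2)).re / |(w'.1.embedding (dV (e.symm k).1 * dW (e.symm k).2)).re|) / 2 : ℝ) : ℂ))))
  (hT2 : ∀ w' : {w : InfinitePlace L // w.IsComplex}, Tinv w' * T w' = 1)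
  (Fr : UnitaryGroup.arch (Fp L) L (IsCMField.complexConj L) (2 + 2) (hermD L e dV hdV dW hdW) → {w : InfinitePlace L // w.IsComplex} → Matrix (Fin 2 ⊕ Fin 2) (Fin 2 ⊕ Fin 2) ℂ)
  (hFr : ∀ (k : UnitaryGroup.arch (Fp L) L (IsCMField.complexConj L) (2 + 2) (hermD L e dV hdV dW hdW)) (w' : {w : InfinitePlace L // w.IsComplex}),
    Fr k w' = T w' * Matrix.reindex (e₂ (n := 2)).symm (e₂ (n := 2)).symm
      (((UnitaryGroup.archAt (Fp L) L (IsCMField.complexConj L) (2 + 2) (hermD L e dV hdV dW hdW) w' (UnitaryGroup.complexConj_smul_infinitePlace L w'.1) (IsCMField.complexConj_ne_one L) k : UnitaryGroup.archLocal L (2 + 2) (hermD L e dV hdV dW hdW) w') : GL (Fin (2 + 2)) ℂ) : Matrix (Fin (2 + 2)) (Fin (2 + 2)) ℂ) * Tinv w')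
  (hFrU : ∀ (k : UnitaryGroup.arch (Fp L) L (IsCMField.complexConj L) (2 + 2) (hermD L e dV hdV dW hdW)) (w' : {w : InfinitePlace L // w.IsComplex}), (Fr k w')ᴴ * Matrix.J (Fin 2) ℂ * Fr k w' = Matrix.J (Fin 2) ℂ)
  -- ★ (A)'s row section and witnesses, the translate with clause (f)
  (γ : Projectivization L (Fin 2 → L) → GL (Fin 2) L)
  (w : skewMatrices ((IsCMField.complexConj L : L ≃ₐ[Fp L] L) : L →+* L) ((gramR L e dV hdV dW hdW).map (algebraMap (Fp L) L)) → Fin 2 → L) (hw : ∀ S, w S ≠ 0)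
  (gc : skewMatrices ((IsCMField.complexConj L : L ≃ₐ[Fp L] L) : L →+* L) ((gramR L e dV hdV dW hdW).map (algebraMap (Fp L) L)) → HA L e dV hdV dW hdW)
  (hgc : ∀ S : skewMatrices ((IsCMField.complexConj L : L ≃ₐ[Fp L] L) : L →+* L) ((gramR L e dV hdV dW hdW).map (algebraMap (Fp L) L)), gc S = Λ (Matrix.GeneralLinearGroup.map (algebraMap L (AdeleRing (𝓞 L) L)) (γ (Projectivization.mk L (w S) (hw S)))))

include hdV0 hdW0 hΛ hTdef hTinvdef hT2 hFr hgc in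
/-- **`hFrL` OF RECORD.**  At the frames of record the tube frame of the corner translate is the framed Levi block times the frame:
`Fr((gc X·h)_∞) w' = fromBlocks (D·σ_{w'}(γ̂ X)·D⁻¹) 0 0 (C·σ_{w'}(γ̌ X)·C⁻¹) · Fr(h_∞) w'` — ★ p865024 `hpw_of_leviFrame`'s letter `hFrL` with `c w' k := √(|t_k|∕2)`,
`c′ w' k := (√(|t_k|∕2))⁻¹` and `A′` the `C`-block (★ p864846 `frame_archAt_levi_of_record` ∘ `map_mul` ∘ ★ p865024 `frameConj_mul`). [cite: HarrisKudlaSweet1996, §1 (1.11)] [cite: Shimura1997, §6.4] -/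
theorem hFrL_of_record :
    ∀ (X : skewMatrices ((IsCMField.complexConj L : L ≃ₐ[Fp L] L) : L →+* L) ((gramR L e dV hdV dW hdW).map (algebraMap (Fp L) L))) (h : HA L e dV hdV dW hdW) (w' : {w : InfinitePlace L // w.IsComplex}),
      Fr (UnitaryGroup.archPart (Fp L) L (IsCMField.complexConj L) (2 + 2) (hermD L e dV hdV dW hdW) (gc X * h)) w' =
        fromBlocks (diagonal (fun k => (Real.sqrt (|(w'.1.embedding (dV (e.symm k).1 * dW (e.symm k).2)).re| / 2) : ℂ)) *
          ((γ (Projectivization.mk L (w X) (hw X)) : GL (Fin 2) L) : Matrix (Fin 2) (Fin 2) L).map w'.1.embedding *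
          diagonal (fun k => (((Real.sqrt (|(w'.1.embedding (dV (e.symm k).1 * dW (e.symm k).2)).re| / 2))⁻¹ : ℝ) : ℂ)))
          0 0 (diagonal (fun k => I * ((((w'.1.embedding (dV (e.symm k).1 * dW (e.symm k).2)).re / |(w'.1.embedding (dV (e.symm k).1 * dW (e.symm k).2)).re|) *
            Real.sqrt (|(w'.1.embedding (dV (e.symm k).1 * dW (e.symm k).2)).re| / 2) : ℝ) : ℂ)) *
          (((gramR L e dV hdV dW hdW).map (algebraMap (Fp L) L))⁻¹ *
              (((((γ (Projectivization.mk L (w X) (hw X)))⁻¹ : GL (Fin 2) L)) : Matrix (Fin 2) (Fin 2) L).map ((IsCMField.complexConj L : L ≃ₐ[Fp L] L) : L →+* L))ᵀ *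
              (gramR L e dV hdV dW hdW).map (algebraMap (Fp L) L)).map w'.1.embedding *
          diagonal (fun k => -(I * (((Real.sqrt (|(w'.1.embedding (dV (e.symm k).1 * dW (e.symm k).2)).re| / 2))⁻¹ *
            ((w'.1.embedding (dV (e.symm k).1 * dW (e.symm k).2)).re / |(w'.1.embedding (dV (e.symm k).1 * dW (e.symm k).2)).re|) : ℝ) : ℂ)))) * Fr (UnitaryGroup.archPart (Fp L) L (IsCMField.complexConj L) (2 + 2) (hermD L e dV hdV dW hdW) h) w' := by
  intro X h w'
  have hmul : Fr (UnitaryGroup.archPart (Fp L) L (IsCMField.complexConj L) (2 + 2) (hermD L e dV hdV dW hdW) (gc X * h)) w' = T w' * Matrix.reindex (e₂ (n := 2)).symm (e₂ (n := 2)).symm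
      (((UnitaryGroup.archAt (Fp L) L (IsCMField.complexConj L) (2 + 2) (hermD L e dV hdV dW hdW) w' (UnitaryGroup.complexConj_smul_infinitePlace L w'.1) (IsCMField.complexConj_ne_one L) (UnitaryGroup.archPart (Fp L) L (IsCMField.complexConj L) (2 + 2) (hermD L e dV hdV dW hdW) (gc X)) : UnitaryGroup.archLocal L (2 + 2) (hermD L e dV hdV dW hdW) w') : GL (Fin (2 + 2)) ℂ) :
        Matrix (Fin (2 + 2)) (Fin (2 + 2)) ℂ) * Tinv w' * Fr (UnitaryGroup.archPart (Fp L) L (IsCMField.complexConj L) (2 + 2) (hermD L e dV hdV dW hdW) h) w' := by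
    have hP : UnitaryGroup.archPart (Fp L) L (IsCMField.complexConj L) (2 + 2) (hermD L e dV hdV dW hdW) (gc X * h) =
        UnitaryGroup.archPart (Fp L) L (IsCMField.complexConj L) (2 + 2) (hermD L e dV hdV dW hdW) (gc X) *
          UnitaryGroup.archPart (Fp L) L (IsCMField.complexConj L) (2 + 2) (hermD L e dV hdV dW hdW) h := map_mul _ _ _
    rw [hFr, hFr, hP, map_mul, Subgroup.coe_mul, Units.val_mul, ← frameConj_mul (hT2 w')]
    rfl
  rw [hmul, hgc X, frame_archAt_levi_of_record L e dV hdV dW hdW hdV0 hdW0 Λ hΛ w' (UnitaryGroup.complexConj_smul_infinitePlace L w'.1)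
    (IsCMField.complexConj_ne_one L) (hTdef w') (hTinvdef w')]

include hdV0 hdW0 hΛ hTdef hTinvdef hFr hFrU hgc in
/-- **`hLevi` OF RECORD.**  The framed Levi block of the corner translate lies in `U(J)` (`hFrU` at `k := (gc X)_∞`, ★ p864846), so by ★ `levi_mem_iff` its diagonal blocks satisfy
`(D·σγ̂·D⁻¹)ᴴ · (C·σγ̌·C⁻¹) = 1` — ★ p865024 `hpw_of_leviFrame`'s letter `hLevi` at the record. [cite: Shimura1997, §5.1, §6.4] -/
theorem hLevi_of_record :
    ∀ (X : skewMatrices ((IsCMField.complexConj L : L ≃ₐ[Fp L] L) : L →+* L) ((gramR L e dV hdV dW hdW).map (algebraMap (Fp L) L))) (w' : {w : InfinitePlace L // w.IsComplex}),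
      (diagonal (fun k => (Real.sqrt (|(w'.1.embedding (dV (e.symm k).1 * dW (e.symm k).2)).re| / 2) : ℂ)) *
          ((γ (Projectivization.mk L (w X) (hw X)) : GL (Fin 2) L) : Matrix (Fin 2) (Fin 2) L).map w'.1.embedding *
          diagonal (fun k => (((Real.sqrt (|(w'.1.embedding (dV (e.symm k).1 * dW (e.symm k).2)).re| / 2))⁻¹ : ℝ) : ℂ)))ᴴ *
        (diagonal (fun k => I * ((((w'.1.embedding (dV (e.symm k).1 * dW (e.symm k).2)).re / |(w'.1.embedding (dV (e.symm k).1 * dW (e.symm k).2)).re|) *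
            Real.sqrt (|(w'.1.embedding (dV (e.symm k).1 * dW (e.symm k).2)).re| / 2) : ℝ) : ℂ)) *
          (((gramR L e dV hdV dW hdW).map (algebraMap (Fp L) L))⁻¹ *
              (((((γ (Projectivization.mk L (w X) (hw X)))⁻¹ : GL (Fin 2) L)) : Matrix (Fin 2) (Fin 2) L).map ((IsCMField.complexConj L : L ≃ₐ[Fp L] L) : L →+* L))ᵀ *
              (gramR L e dV hdV dW hdW).map (algebraMap (Fp L) L)).map w'.1.embedding *
          diagonal (fun k => -(I * (((Real.sqrt (|(w'.1.embedding (dV (e.symm k).1 * dW (e.symm k).2)).re| / 2))⁻¹ *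
            ((w'.1.embedding (dV (e.symm k).1 * dW (e.symm k).2)).re / |(w'.1.embedding (dV (e.symm k).1 * dW (e.symm k).2)).re|) : ℝ) : ℂ)))) = 1 := by
  intro X w'
  have hU := hFrU (UnitaryGroup.archPart (Fp L) L (IsCMField.complexConj L) (2 + 2) (hermD L e dV hdV dW hdW) (gc X)) w'
  rw [hFr, hgc X, frame_archAt_levi_of_record L e dV hdV dW hdW hdV0 hdW0 Λ hΛ w' (UnitaryGroup.complexConj_smul_infinitePlace L w'.1)
    (IsCMField.complexConj_ne_one L) (hTdef w') (hTinvdef w')] at hU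
  exact (levi_mem_iff _ _).1 hU

include hdV hdW hdV0 hdW0 in
/-- **THE (c)-CONSTANT OF RECORD.**  On the finite set `Tinf` there is `κ > 0` with `κ ≤ 2‖c w' 1‖²·‖c′ w' k‖²` for the record moduli `c w' k = √(|t_k|∕2)`, `c′ = c⁻¹`
(`t_k = Re σ_{w'}(dV·dW) ≠ 0`, ★ `tw_ne_zero`; the value is `2|t₁|∕|t_k|`) — ★ p865024 `hV_twisted_of_untwistedFloor`'s `hκ` together with `0 < κ` for the tie's `hcV`. [cite: Shimura1997, §6.5] -/
theorem exists_kappa_of_record (Tinf : Finset (InfinitePlace L)) :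
    ∃ κ : ℝ, 0 < κ ∧ ∀ w' ∈ Tinf, ∀ k : Fin 2,
      κ ≤ 2 * ‖(Real.sqrt (|(w'.embedding (dV (e.symm 1).1 * dW (e.symm 1).2)).re| / 2) : ℂ)‖ ^ 2 *
        ‖(((Real.sqrt (|(w'.embedding (dV (e.symm k).1 * dW (e.symm k).2)).re| / 2))⁻¹ : ℝ) : ℂ)‖ ^ 2 := by
  classical
  have hpos : ∀ (w' : InfinitePlace L) (k : Fin 2),
      0 < 2 * ‖(Real.sqrt (|(w'.embedding (dV (e.symm 1).1 * dW (e.symm 1).2)).re| / 2) : ℂ)‖ ^ 2 *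
        ‖(((Real.sqrt (|(w'.embedding (dV (e.symm k).1 * dW (e.symm k).2)).re| / 2))⁻¹ : ℝ) : ℂ)‖ ^ 2 := by
    intro w' k
    have hsq : ∀ j : Fin 2, 0 < Real.sqrt (|(w'.embedding (dV (e.symm j).1 * dW (e.symm j).2)).re| / 2) := fun j =>
      Real.sqrt_pos.2 (div_pos (abs_pos.2
        (tw_ne_zero L e dV hdV dW hdW ⟨w', IsTotallyComplex.isComplex w'⟩ (UnitaryGroup.complexConj_smul_infinitePlace L w') hdV0 hdW0 j)) two_pos)
    have h1 : 0 < ‖(Real.sqrt (|(w'.embedding (dV (e.symm 1).1 * dW (e.symm 1).2)).re| / 2) : ℂ)‖ := by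
      rw [Complex.norm_real, Real.norm_eq_abs, abs_of_pos (hsq 1)]; exact hsq 1
    have h2 : 0 < ‖(((Real.sqrt (|(w'.embedding (dV (e.symm k).1 * dW (e.symm k).2)).re| / 2))⁻¹ : ℝ) : ℂ)‖ := by
      rw [Complex.norm_real, Real.norm_eq_abs, abs_of_pos (inv_pos.2 (hsq k))]; exact inv_pos.2 (hsq k)
    exact mul_pos (mul_pos two_pos (pow_pos h1 2)) (pow_pos h2 2)
  by_cases hT : Tinf.Nonempty
  · obtain ⟨p, hp, hmin⟩ := Finset.exists_min_image (Tinf ×ˢ (Finset.univ : Finset (Fin 2)))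
      (fun p : InfinitePlace L × Fin 2 =>
        2 * ‖(Real.sqrt (|(p.1.embedding (dV (e.symm 1).1 * dW (e.symm 1).2)).re| / 2) : ℂ)‖ ^ 2 *
          ‖(((Real.sqrt (|(p.1.embedding (dV (e.symm p.2).1 * dW (e.symm p.2).2)).re| / 2))⁻¹ : ℝ) : ℂ)‖ ^ 2)
      (hT.product Finset.univ_nonempty)
    exact ⟨_, hpos p.1 p.2, fun w' hw' k => hmin (w', k) (Finset.mem_product.2 ⟨hw', Finset.mem_univ k⟩)⟩
  · exact ⟨1, one_pos, fun w' hw' => (hT ⟨w', hw'⟩).elim⟩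

end Summit.HodgeConjecture.HodgeConjecture.Cruxes.HLiu418.K2LiuKindOneSingularCornerTranslateOfRecord

end
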